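import Mathlib
import Summits.Ventures.HodgeRepro.Tier4.Target
import Summits.Ventures.HodgeRepro.Tier4.Line3.KMDatumS
import Summits.Ventures.HodgeRepro.Tier4.Line3.Defs
import Summits.Ventures.HodgeRepro.Tier4.Line3.LocaliserS
import Summits.Ventures.HodgeRepro.Tier4.Line3.MajorantLemmas
import Summits.Ventures.HodgeRepro.Tier4.Line3.IntegrableMajorant
import Summits.Ventures.HodgeRepro.Tier4.Line3.ExpansionPointwise
import Summits.Ventures.HodgeRepro.Tier4.Line3.Expansion
import Summits.Ventures.HodgeRepro.Tier4.Line3.DecaySum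

/-!
# Tier4/Line3/TermDominatedAssembly — L3.5 `term_dominated` REDUCED to one displayed analytic residual

Blind re-derivation cell `pub-hodge-repro`, Tier 4 «PROVE THE STEP» (README §9–§10), seat t4-L2-p1 (gen 0), seated on
L3.5 with t4-L2-p3 by the lead's line table (S12654).  t4-L2-p3's rungs (the class bound `ClassBound.summand_bound_off_main`,
`DecaySum`, the orbit-mass step of `TermMajorantMass`) leave, by their own census (S12695 / S12735), the analytic core
(vi): an `N`-INDEPENDENT majorant of the off-main summands whose mass over the depth-`N` domain grows at most
geometrically in `N`.  As drafted there (`MajorantIntegralBound`, proofs/t4-L2-p3/Tier4/Line3/Assembly-draft.lean)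
the residual is UNSATISFIABLE: its clause `Summable (fun w => majorantAt Φ e w z)` sums the `τ₀`-Gaussian majorant over
ALL line tuples, and `ballCoord` sends a lattice `L ⊂ E′³` to a rank-`6d′` subgroup of `ℂ³`, dense in its span once
`d′ = [E′⁺ : ℚ] ≥ 2` (`X.hE`) — the sum diverges (S12697).  This module states the residual in a SATISFIABLE shape and
PROVES the reduction:

* `T4Data.OffMainMass ℓ` — the displayed residual, CHOICE-INDEPENDENT: the OFF-MAIN MASS at depth `N`,
  `∫⁻_{D_N} Σ'_{w off-main} ‖summand (loc N) w z‖ₑ`, is at most `M₀ q₁^N e^{−κ q^{N/d}}`.  Its left side is a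
  `Γ_N`-invariant density integrated over a fundamental domain of the level, so it does not depend on which relatively
  compact fundamental domain `T4Data.domain` chose (t4-L2-p3's caveat S12794); `q₁^N` is the room for the index of the
  level (`LocS.level_le`), `e^{−κ q^{N/d}}` the decay of the class bound.  What proves it for the genuine data — the
  class bound with the support and the definite Gaussians of `LocS.growth` kept in the majorant, the lattice Gaussian
  sums over the finitely many support lattices, the tiling of a domain of the level by coset representatives and the
  BHC cocompactness row — is the honest residual of L3.5.
* `T4Data.term_dominated_of_offMainMass` — with it, L3.5 `term_dominated` follows: `bound o := Σ_N (the orbit `o`'s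
  share of the depth-`N` off-main mass)`, summable over the orbits because the shares regroup by the fibres of
  `orbitOf` (`ENNReal.tsum_fiberwise`, Tonelli), and `Σ_N M₀ q₁^N e^{−κ q^{N/d}} < ∞`
  (`DecaySum.summable_pow_mul_exp_neg_root`: `q = N(𝔭) ≥ 2`, `d = [E′ : ℚ] ≥ 1`).  Everything is done in `ℝ≥0∞` (no
  integrability side conditions); the term bound uses only `‖∫ f‖ₑ ≤ ∫⁻ ‖f‖ₑ` and the pointwise absolute convergence
  of the quadruple series (`IntegrableMajorant.summable_norm_summand`, L3.2a).

No printed input enters this module.  Nothing here says anything about the status of the Hodge conjecture for CM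
abelian varieties, which is NOT proved (HC_CM is NOT proved by anyone in this repository).
-/

set_option autoImplicit false

noncomputable section

namespace Summit.Ventures.HodgeRepro.Tier4.Line3

open Summit.Ventures.HodgeRepro.Tier4
open MeasureTheory Filter Topology
open scoped ENNReal

namespace T4Data

variable (X : T4Data)

/-- The off-main decay factor at depth `N`: `e^{−κ (N(𝔭)^N)^{1/[E′:ℚ]}}` (the shape of the class bound). -/
def offMainDecay (p : IsDedekindDomain.HeightOneSpectrum (NumberField.RingOfIntegers X.E)) (κ : ℝ) (N : ℕ) : ℝ :=
  Real.exp (-(κ * (((Ideal.absNorm p.asIdeal : ℝ) ^ N) ^ ((Module.finrank ℚ X.E : ℝ)⁻¹))))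

/-- The decay factor is non-negative. -/
theorem offMainDecay_nonneg (p : IsDedekindDomain.HeightOneSpectrum (NumberField.RingOfIntegers X.E)) (κ : ℝ)
    (N : ℕ) : 0 ≤ X.offMainDecay p κ N :=
  (Real.exp_pos _).le

/-- The orbits are countable (a quotient of the countable line tuples). -/
instance countable_orbit' : Countable X.Orbit := by
  unfold T4Data.Orbit
  infer_instance

/-- **THE RESIDUAL OF L3.5, displayed**: the OFF-MAIN MASS at depth `N` — the integral over the depth-`N` domain of the
sum of the absolute values of the off-main summands — is at most `M₀ q₁^N · e^{−κ q^{N/d}}`.  The left side is the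
`Γ_N`-invariant density of the off-main part of the quadruple series integrated over a fundamental domain of the
level, so it does not depend on which (relatively compact) fundamental domain `T4Data.domain` chose; `q₁^N` is the
room for the index of the level (`LocS.level_le`: `≤ (q₀^d)^{9N}`), `e^{−κ q^{N/d}}` the decay of the class bound
(t4-L2-p3, `ClassBound.summand_bound_off_main`).  Everything L3.5 still needs is this one displayed statement. -/
structure OffMainMass (D : X.ThetaData) (p : IsDedekindDomain.HeightOneSpectrum (NumberField.RingOfIntegers X.E))
    (L₀ : Submodule (NumberField.RingOfIntegers X.E) (Fin 3 → X.E)) (xm : X.Tuple) (ℓ : X.LocS D p L₀ xm) where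
  /-- the decay rate -/
  κ : ℝ
  κ_pos : 0 < κ
  /-- the mass constants -/
  M₀ : ℝ
  q₁ : ℝ
  M₀_nonneg : 0 ≤ M₀
  q₁_nonneg : 0 ≤ q₁
  /-- the off-main mass at depth `N` -/
  mass : ∀ N, ∫⁻ z in X.domain (ℓ.level N),
      ∑' w : {w : X.LineTuple // X.orbitOf w ≠ X.orbitOf (X.lines xm)}, ‖X.summand D.Φ D.cf (ℓ.loc N) w.1 z‖ₑ ≤
    ENNReal.ofReal (M₀ * q₁ ^ N * X.offMainDecay p κ N)

namespace OffMainMass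

variable {X}
variable {D : X.ThetaData} {p : IsDedekindDomain.HeightOneSpectrum (NumberField.RingOfIntegers X.E)}
  {L₀ : Submodule (NumberField.RingOfIntegers X.E) (Fin 3 → X.E)} {xm : X.Tuple} {ℓ : X.LocS D p L₀ xm}

/-- The orbit `o`'s share of the depth-`N` mass, in `ℝ≥0∞`. -/
def orbitMass (N : ℕ) (o : X.Orbit) : ℝ≥0∞ :=
  ∫⁻ z in X.domain (ℓ.level N), ∑' w : {w : X.LineTuple // X.orbitOf w = o}, ‖X.summand D.Φ D.cf (ℓ.loc N) w.1 z‖ₑ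

/-- The `ℝ≥0∞`-valued bound of the orbit `o`: its depth-`N` masses summed over `N`. -/
def boundE (o : X.Orbit) : ℝ≥0∞ := ∑' N : ℕ, orbitMass (ℓ := ℓ) N o

/-- Measurability of the summands' norms on the depth-`N` domain. -/
theorem aemeasurable_enorm_summand (N : ℕ) (w : X.LineTuple) :
    AEMeasurable (fun z => ‖X.summand D.Φ D.cf (ℓ.loc N) w z‖ₑ) (volume.restrict (X.domain (ℓ.level N))) :=
  (Expansion.aestronglyMeasurable_summand X D (ℓ.level N) (ℓ.loc N) w).enorm

/-- The off-main orbit masses at depth `N` regroup to the off-main mass (Tonelli + the fibres of `orbitOf` over the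
off-main line tuples). -/
theorem tsum_orbitMass_offMain (N : ℕ) :
    ∑' o : {o : X.Orbit // o ≠ X.orbitOf (X.lines xm)}, orbitMass (ℓ := ℓ) N o.1 =
      ∫⁻ z in X.domain (ℓ.level N),
        ∑' w : {w : X.LineTuple // X.orbitOf w ≠ X.orbitOf (X.lines xm)}, ‖X.summand D.Φ D.cf (ℓ.loc N) w.1 z‖ₑ := by
  unfold orbitMass
  have hmeas : ∀ o : {o : X.Orbit // o ≠ X.orbitOf (X.lines xm)}, AEMeasurable
      (fun z => ∑' w : {w : X.LineTuple // X.orbitOf w = o.1}, ‖X.summand D.Φ D.cf (ℓ.loc N) w.1 z‖ₑ)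
      (volume.restrict (X.domain (ℓ.level N))) :=
    fun o => AEMeasurable.tsum fun w => aemeasurable_enorm_summand (ℓ := ℓ) N w.1
  rw [← lintegral_tsum hmeas]
  refine lintegral_congr fun z => ?_
  -- the off-main line tuples, fibred by their orbit
  let F : X.LineTuple → ℝ≥0∞ := fun w => ‖X.summand D.Φ D.cf (ℓ.loc N) w z‖ₑ
  let g : {w : X.LineTuple // X.orbitOf w ≠ X.orbitOf (X.lines xm)} → {o : X.Orbit // o ≠ X.orbitOf (X.lines xm)} :=
    fun w => ⟨X.orbitOf w.1, w.2⟩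
  have h := ENNReal.tsum_fiberwise (fun w : {w : X.LineTuple // X.orbitOf w ≠ X.orbitOf (X.lines xm)} => F w.1) g
  rw [← h]
  refine tsum_congr fun o => ?_
  -- the fibre of `g` over `o` is the fibre of `orbitOf` over `o.1`
  let e : g ⁻¹' {o} ≃ {w : X.LineTuple // X.orbitOf w = o.1} :=
    { toFun := fun w => ⟨w.1.1, by
        have := w.2
        simp only [Set.mem_preimage, Set.mem_singleton_iff, g] at this
        exact congrArg Subtype.val this⟩
      invFun := fun w => ⟨⟨w.1, by rw [w.2]; exact o.2⟩, by
        simp only [Set.mem_preimage, Set.mem_singleton_iff, g]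
        exact Subtype.ext w.2⟩
      left_inv := fun w => rfl
      right_inv := fun w => rfl }
  exact (e.tsum_eq (fun w => F w.1)).symm

/-- `N(𝔭) ≥ 2` for a non-zero prime of the ring of integers. -/
theorem one_lt_absNorm (p : IsDedekindDomain.HeightOneSpectrum (NumberField.RingOfIntegers X.E)) :
    1 < (Ideal.absNorm p.asIdeal : ℝ) := by
  have h0 : Ideal.absNorm p.asIdeal ≠ 0 := by
    rw [Ne, Ideal.absNorm_eq_zero_iff]
    exact p.ne_bot
  have h1 : Ideal.absNorm p.asIdeal ≠ 1 := by
    rw [Ne, Ideal.absNorm_eq_one_iff]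
    exact p.isPrime.ne_top
  have : 2 ≤ Ideal.absNorm p.asIdeal := by omega
  exact_mod_cast this

/-- The total off-main bound `Σ_{o ≠ main} boundE o` is finite: `Σ_N M₀ q₁^N e^{−κ q^{N/d}} < ∞`. -/
theorem tsum_boundE_ne_top (H : X.OffMainMass D p L₀ xm ℓ) :
    ∑' o : {o : X.Orbit // o ≠ X.orbitOf (X.lines xm)}, boundE (ℓ := ℓ) o.1 ≠ ⊤ := by
  have hd : 1 ≤ Module.finrank ℚ X.E := Module.finrank_pos
  have hsum : Summable (fun N : ℕ => H.q₁ ^ N * Real.exp (-(H.κ * (((Ideal.absNorm p.asIdeal : ℝ) ^ N) ^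
      ((Module.finrank ℚ X.E : ℝ)⁻¹))))) :=
    summable_pow_mul_exp_neg_root H.q₁_nonneg (one_lt_absNorm p) H.κ_pos hd
  have hsum' : Summable (fun N : ℕ => H.M₀ * (H.q₁ ^ N * Real.exp (-(H.κ * (((Ideal.absNorm p.asIdeal : ℝ) ^ N) ^
      ((Module.finrank ℚ X.E : ℝ)⁻¹)))))) := hsum.mul_left H.M₀
  refine ne_top_of_le_ne_top (ENNReal.ofReal_ne_top (r := ∑' N : ℕ, H.M₀ * (H.q₁ ^ N * Real.exp (-(H.κ *
    (((Ideal.absNorm p.asIdeal : ℝ) ^ N) ^ ((Module.finrank ℚ X.E : ℝ)⁻¹))))))) ?_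
  calc ∑' o : {o : X.Orbit // o ≠ X.orbitOf (X.lines xm)}, boundE (ℓ := ℓ) o.1
      = ∑' N : ℕ, ∑' o : {o : X.Orbit // o ≠ X.orbitOf (X.lines xm)}, orbitMass (ℓ := ℓ) N o.1 := by
        unfold boundE
        exact ENNReal.tsum_comm
    _ ≤ ∑' N : ℕ, ENNReal.ofReal (H.M₀ * H.q₁ ^ N * X.offMainDecay p H.κ N) := by
        refine ENNReal.tsum_le_tsum fun N => ?_
        rw [tsum_orbitMass_offMain]
        exact H.mass N
    _ = ENNReal.ofReal (∑' N : ℕ, H.M₀ * (H.q₁ ^ N * Real.exp (-(H.κ * (((Ideal.absNorm p.asIdeal : ℝ) ^ N) ^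
          ((Module.finrank ℚ X.E : ℝ)⁻¹)))))) := by
        rw [ENNReal.ofReal_tsum_of_nonneg (fun N => mul_nonneg H.M₀_nonneg (mul_nonneg (pow_nonneg H.q₁_nonneg _)
          (Real.exp_pos _).le)) hsum']
        refine tsum_congr fun N => ?_
        congr 1
        unfold offMainDecay
        ring

/-- Every off-main `boundE o` is finite. -/
theorem boundE_ne_top (H : X.OffMainMass D p L₀ xm ℓ) (o : X.Orbit) (ho : o ≠ X.orbitOf (X.lines xm)) :
    boundE (ℓ := ℓ) o ≠ ⊤ :=
  ne_top_of_le_ne_top H.tsum_boundE_ne_top (ENNReal.le_tsum (⟨o, ho⟩ : {o : X.Orbit // o ≠ X.orbitOf (X.lines xm)}))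

/-- **THE TERM BOUND**: `‖term_N o‖ ≤ orbitMass N o` (`‖∫ f‖ ≤ ∫⁻ ‖f‖ₑ` and `‖Σ' f‖ ≤ Σ' ‖f‖` on the fibre, the latter
absolutely convergent by L3.2a's pointwise summability). -/
theorem enorm_term_le (N : ℕ) (o : X.Orbit) :
    ‖X.term D.Φ D.cf (ℓ.level N) (ℓ.loc N) o‖ₑ ≤ orbitMass (ℓ := ℓ) N o := by
  unfold T4Data.term orbitMass
  refine le_trans (enorm_integral_le_lintegral_enorm _) (lintegral_mono_ae ?_)
  refine (ae_restrict_mem (IntegrableMajorant.measurableSet_domain X _)).mono fun z hz => ?_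
  have hzb : z ∈ ball := IntegrableMajorant.domain_subset_ball X _ hz
  have hS : Summable (fun w : {w : X.LineTuple // X.orbitOf w = o} =>
      ‖X.summand D.Φ D.cf (ℓ.loc N) w.1 z‖) :=
    (IntegrableMajorant.summable_norm_summand X D (ℓ.loc N) hzb).subtype _
  calc ‖∑' w : {w : X.LineTuple // X.orbitOf w = o}, X.summand D.Φ D.cf (ℓ.loc N) w.1 z‖ₑ
      = ENNReal.ofReal ‖∑' w : {w : X.LineTuple // X.orbitOf w = o}, X.summand D.Φ D.cf (ℓ.loc N) w.1 z‖ :=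
        (ofReal_norm _).symm
    _ ≤ ENNReal.ofReal (∑' w : {w : X.LineTuple // X.orbitOf w = o}, ‖X.summand D.Φ D.cf (ℓ.loc N) w.1 z‖) :=
        ENNReal.ofReal_le_ofReal (norm_tsum_le_tsum_norm hS)
    _ = ∑' w : {w : X.LineTuple // X.orbitOf w = o}, ‖X.summand D.Φ D.cf (ℓ.loc N) w.1 z‖ₑ := by
        rw [ENNReal.ofReal_tsum_of_nonneg (fun w => norm_nonneg _) hS]
        exact tsum_congr fun w => ofReal_norm _

end OffMainMass

/-- **L3.5 REDUCED TO ITS RESIDUAL**: an `OffMainMass` gives one summable majorant of the off-main orbital terms at all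
depths — the conclusion of `term_dominated`, verbatim. -/
theorem term_dominated_of_offMainMass (D : X.ThetaData)
    {p : IsDedekindDomain.HeightOneSpectrum (NumberField.RingOfIntegers X.E)}
    {L₀ : Submodule (NumberField.RingOfIntegers X.E) (Fin 3 → X.E)} {xm : X.Tuple} (ℓ : X.LocS D p L₀ xm)
    (H : X.OffMainMass D p L₀ xm ℓ) :
    ∃ bound : X.Orbit → ℝ, (∀ o, 0 ≤ bound o) ∧ Summable bound ∧
      ∀ N (o : X.Orbit), o ≠ X.orbitOf (X.lines xm) → ‖X.term D.Φ D.cf (ℓ.level N) (ℓ.loc N) o‖ ≤ bound o := by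
  classical
  -- the bound: the orbit's total mass off the main orbit, `0` on the main orbit
  let bnd : X.Orbit → ℝ := fun o =>
    if o = X.orbitOf (X.lines xm) then 0 else (OffMainMass.boundE (ℓ := ℓ) o).toReal
  have hbnd_nonneg : ∀ o, 0 ≤ bnd o := fun o => by
    simp only [bnd]
    split_ifs
    · exact le_rfl
    · exact ENNReal.toReal_nonneg
  have hbnd_off : ∀ o, o ≠ X.orbitOf (X.lines xm) → bnd o = (OffMainMass.boundE (ℓ := ℓ) o).toReal :=
    fun o ho => by simp only [bnd, if_neg ho]
  have hbnd_main : bnd (X.orbitOf (X.lines xm)) = 0 := by simp only [bnd, if_true]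
  refine ⟨bnd, hbnd_nonneg, ?_, fun N o ho => ?_⟩
  · -- summability: the off-main subtype carries a finite `ℝ≥0∞`-total; the main orbit contributes `0`
    have hsub : Summable (fun o : {o : X.Orbit // o ≠ X.orbitOf (X.lines xm)} =>
        (OffMainMass.boundE (ℓ := ℓ) o.1).toReal) :=
      ENNReal.summable_toReal H.tsum_boundE_ne_top
    have hext : Summable (fun o : {o : X.Orbit | o ≠ X.orbitOf (X.lines xm)} => bnd o.1) :=
      hsub.congr fun o => (hbnd_off o.1 o.2).symm
    have hind : Summable (Set.indicator {o : X.Orbit | o ≠ X.orbitOf (X.lines xm)} bnd) :=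
      (summable_subtype_iff_indicator (f := bnd) (s := {o : X.Orbit | o ≠ X.orbitOf (X.lines xm)})).mp hext
    refine hind.congr fun o => ?_
    by_cases h : o = X.orbitOf (X.lines xm)
    · rw [Set.indicator_of_notMem (by simpa using h), h, hbnd_main]
    · exact Set.indicator_of_mem (by simpa using h) bnd
  · rw [hbnd_off o ho]
    have h1 : ‖X.term D.Φ D.cf (ℓ.level N) (ℓ.loc N) o‖ₑ ≤ OffMainMass.boundE (ℓ := ℓ) o :=
      (OffMainMass.enorm_term_le (ℓ := ℓ) N o).trans (ENNReal.le_tsum N)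
    have h2 := ENNReal.toReal_mono (H.boundE_ne_top o ho) h1
    rwa [toReal_enorm] at h2

end T4Data

end Summit.Ventures.HodgeRepro.Tier4.Line3

end
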